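import Mathlib
import HarnessLib
import Literature.Analysis.FunctionSpaces.FractionalSobolevLocalizedL3Bound
import Summits.NavierStokesRegularity.NavierStokesRegularity.Theorems.ChiralWindowDoorDefs
import Summits.NavierStokesRegularity.NavierStokesRegularity.Theorems.ChiralWindowDoorGagliardoIdentity
import Summits.NavierStokesRegularity.NavierStokesRegularity.Theorems.ChiralWindowDoorLocalHelicityLower

/-!
# Door S20 «ChiralWindowDoor» — stub B5a `stub_sobolevFatou` in CLASS FORM, PROVED: a uniform bound on the windowed
# Gagliardo forms of the slices of a door-class profile bounds the slices in `L³(B₁)`, uniformly in `t ∈ (−1,0)`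

Door S20 of nsreg-p1's local Type-I door family (`HOME/ns-regularity-ideate-p1/r19/R19-LINE.md` §B5, line
`r19/Sketch20v5.lean` 7f13084196f4f031; DESIGN-ONLY, route NOT born).  The print side of B5a is the tree's localised
fractional Gagliardo–Sobolev inequality under scale-invariant decay
(`Literature.Analysis.FunctionSpaces.DiNezzaPalatucciValdinoci2012.exists_lintegral_ball_cube_le_rpow_of_decay_R3`,
Di Nezza–Palatucci–Valdinoci 2012 Thm 6.5 localised by Lemma 5.3, typed by nsreg-typer g15): for a.e.-strongly
measurable `f` on `ℝ³` with `‖x‖‖f x‖ ≤ D`,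
`∫_{B₁} ‖f‖³ ≤ (C ∫_{x∈B₂}∫_y ‖f x − f y‖²/‖x−y‖⁴ + C D²)^{3/2}` with an absolute `C < ∞`.

This file supplies the Summits-side glue and proves B5a for DOOR-CLASS profiles:

* `lintegral_sq_div_le_ofReal_symG` — pointwise, where the weight is `≥ 1` in the first variable, the extended
  integrand `‖f x − f y‖ₑ²/‖x − y‖ₑ⁴` is `≤ ofReal (π² · symG a f lamK (x,y))` (`π² lamK (x−y) = ‖x−y‖⁻⁴`);
* `setLIntegral_gagliardo_le` — for a non-negative weight `a ≥ 1` on a measurable set `S` and an INTEGRABLE Gagliardo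
  integrand, `∫⁻_{x∈S} ∫⁻_y ‖f x − f y‖ₑ²/‖x−y‖ₑ⁴ ≤ ofReal (4π² · gagliardo a f)` (Tonelli + `ofReal ∫ = ∫⁻ ofReal`);
* `norm_mul_norm_le_of_hasTypeIDecay` — `‖x‖ ‖v t x‖ ≤ D` from `HasTypeIDecay D v`;
* `sobolevFatou_of_class` — **B5a in class form**: for a door-class profile (Type-I time rate, Type-I decay, the R19
  derivative binder, continuity on the open backward slab, the unit-viscosity Oseen–Duhamel identity) a bound
  `gagliardo (bumpSq η R) (v t₀) ≤ c` uniform in `R > 0`, `t₀ < 0` gives `M` with `∫⁻_{B₁} ‖v t‖ₑ³ ≤ M` for all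
  `t ∈ (−1,0)`.  Only `R = 2` is used (`bumpSq η 2 = 1` on `B₂`), so no Fatou / `R → ∞` step is needed; the class
  regularity of the slices (`…LocalHelicityLower.slice_regularity`: bounded, Lipschitz, continuous) makes the Gagliardo
  integrand integrable (`…GagliardoIdentity.integrable_symG_lamK`), which is what turns the Bochner-integral hypothesis
  into a bound on the extended (lintegral) Gagliardo energy.

REMARK on the literal text of `stub_sobolevFatou` (which omits the Oseen–Duhamel identity): it is NOT provable as
printed, for junk-value reasons — for a continuous profile whose slices are nowhere differentiable in `x` the binder
`HasTypeIDerivDecay` holds vacuously (`fderiv = 0`), the Gagliardo integrand may fail to be integrable (Bochner value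
`0`, so the hypothesis `gagliardo ≤ c` is empty) while `∫_{B₁}‖v t‖³` grows like `log(1/(−t))` under the Type-I decay
`D/(‖x‖+√(−t))` alone.  The composition `homochiralProfileRigidity_of_B` only ever applies B5a to door-class profiles,
so the class form below is exactly what the residue line consumes (see `…ChiralWindowDoorProfileRigidityOfB3`).

Seat nsreg-p6 g12 (THEOREMS-ONLY door sequels, DIRECTOR-NS g8 #32 (2)/#36).  WHAT THIS IS NOT: not NS regularity
(Clay A); not K2 — one stub of the residue line of a DESIGN-ONLY door; no route is opened.
-/

noncomputable section

-- the summit and its single sub-problem share the name (CONVENTIONS §1), as in every Theorems file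
set_option linter.dupNamespace false

namespace Summit.NavierStokesRegularity.NavierStokesRegularity.Theorems.ChiralWindowDoorSobolevFatou

open MeasureTheory Set Filter Topology Metric Function
open scoped RealInnerProductSpace ENNReal NNReal
open Literature.Analysis Literature.Analysis.FluidPDE
open Literature.Analysis.FunctionSpaces.DiNezzaPalatucciValdinoci2012 (exists_lintegral_ball_cube_le_rpow_of_decay_R3)
open Summit.NavierStokesRegularity.NavierStokesRegularity.Theorems.ChiralWindowDoorDefs
open Summit.NavierStokesRegularity.NavierStokesRegularity.Theorems.ChiralWindowDoorGagliardoIdentity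
  (integrable_symG_lamK)
open Summit.NavierStokesRegularity.NavierStokesRegularity.Theorems.ChiralWindowDoorLocalHelicityLower
  (slice_regularity continuous_bumpSq hasCompactSupport_bumpSq)

/-! ### From the weighted Gagliardo form (Bochner) to the extended Gagliardo energy (lintegral) -/

section Glue

variable {a : EuclideanSpace ℝ (Fin 3) → ℝ} {f : EuclideanSpace ℝ (Fin 3) → EuclideanSpace ℝ (Fin 3)}

/-- Pointwise: `‖f x − f y‖ₑ² / ‖x − y‖ₑ⁴ = ofReal (π² · lamK (x−y) · ‖f x − f y‖²)` (both sides vanish on the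
diagonal: `lamK 0 = 0` by the junk value `0⁻¹ = 0`, and `0/0 = 0` in `ℝ≥0∞`). -/
theorem enorm_sq_div_eq_ofReal (x y : EuclideanSpace ℝ (Fin 3)) :
    ‖f x - f y‖ₑ ^ (2 : ℝ) / ‖x - y‖ₑ ^ (4 : ℝ) =
      ENNReal.ofReal (Real.pi ^ 2 * (lamK (x - y) * ‖f x - f y‖ ^ 2)) := by
  have e2 : ‖f x - f y‖ₑ ^ (2 : ℝ) = ENNReal.ofReal (‖f x - f y‖ ^ 2) := by
    rw [ENNReal.ofReal_pow (norm_nonneg _), ofReal_norm, ENNReal.rpow_ofNat]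
  have e4 : ‖x - y‖ₑ ^ (4 : ℝ) = ENNReal.ofReal (‖x - y‖ ^ 4) := by
    rw [ENNReal.ofReal_pow (norm_nonneg _), ofReal_norm, ENNReal.rpow_ofNat]
  rw [e2, e4]
  by_cases hxy : x = y
  · subst hxy
    simp [lamK]
  · have hpos : 0 < ‖x - y‖ ^ 4 := by
      have : 0 < ‖x - y‖ := norm_pos_iff.2 (sub_ne_zero.2 hxy)
      positivity
    rw [← ENNReal.ofReal_div_of_pos hpos]
    congr 1
    unfold lamK
    have hπ : Real.pi ^ 2 ≠ 0 := by positivity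
    field_simp

/-- Where the (non-negative) weight is `≥ 1` in the first variable, the extended Gagliardo integrand is dominated by
`ofReal (π² · symG a f lamK)`. -/
theorem enorm_sq_div_le_ofReal_symG (hann : ∀ z, 0 ≤ a z) {x : EuclideanSpace ℝ (Fin 3)} (hx : 1 ≤ a x)
    (y : EuclideanSpace ℝ (Fin 3)) :
    ‖f x - f y‖ₑ ^ (2 : ℝ) / ‖x - y‖ₑ ^ (4 : ℝ) ≤ ENNReal.ofReal (Real.pi ^ 2 * symG a f lamK (x, y)) := by
  rw [enorm_sq_div_eq_ofReal]
  refine ENNReal.ofReal_le_ofReal (mul_le_mul_of_nonneg_left ?_ (by positivity))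
  unfold symG
  have hK : 0 ≤ lamK (x - y) * ‖f x - f y‖ ^ 2 := mul_nonneg (lamK_nonneg _) (sq_nonneg _)
  have h1 : 1 ≤ a x + a y := le_add_of_le_of_nonneg hx (hann y)
  calc lamK (x - y) * ‖f x - f y‖ ^ 2 = 1 * (lamK (x - y) * ‖f x - f y‖ ^ 2) := (one_mul _).symm
    _ ≤ (a x + a y) * (lamK (x - y) * ‖f x - f y‖ ^ 2) := mul_le_mul_of_nonneg_right h1 hK

/-- **Bochner ⇒ lintegral.**  For a non-negative weight `a` that is `≥ 1` on a measurable set `S` and an INTEGRABLE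
Gagliardo integrand `symG a f lamK`, the extended Gagliardo energy of `f` over `S × ℝ³` is bounded by `4π²` times the
weighted Gagliardo form: `∫⁻_{x∈S} ∫⁻_y ‖f x − f y‖ₑ²/‖x−y‖ₑ⁴ ≤ ofReal (4π² · gagliardo a f)`. -/
theorem setLIntegral_enorm_sq_div_le_gagliardo (hann : ∀ z, 0 ≤ a z) {S : Set (EuclideanSpace ℝ (Fin 3))}
    (hS : MeasurableSet S) (hS1 : ∀ x ∈ S, 1 ≤ a x) (hint : Integrable (symG a f lamK)) :
    ∫⁻ x in S, ∫⁻ y, ‖f x - f y‖ₑ ^ (2 : ℝ) / ‖x - y‖ₑ ^ (4 : ℝ) ≤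
      ENNReal.ofReal (4 * Real.pi ^ 2 * gagliardo a f) := by
  set G : EuclideanSpace ℝ (Fin 3) × EuclideanSpace ℝ (Fin 3) → ℝ≥0∞ := fun p =>
    ENNReal.ofReal (Real.pi ^ 2 * symG a f lamK p) with hG
  have hGm : AEMeasurable G (volume : Measure (EuclideanSpace ℝ (Fin 3) × EuclideanSpace ℝ (Fin 3))) :=
    ENNReal.measurable_ofReal.comp_aemeasurable (hint.aestronglyMeasurable.aemeasurable.const_mul _)
  -- Step 1: dominate on `S`, then drop the restriction
  have h1 : ∫⁻ x in S, ∫⁻ y, ‖f x - f y‖ₑ ^ (2 : ℝ) / ‖x - y‖ₑ ^ (4 : ℝ) ≤ ∫⁻ x in S, ∫⁻ y, G (x, y) := by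
    refine lintegral_mono_ae ((ae_restrict_mem hS).mono fun x hx => ?_)
    exact lintegral_mono fun y => enorm_sq_div_le_ofReal_symG hann (hS1 x hx) y
  have h2 : ∫⁻ x in S, ∫⁻ y, G (x, y) ≤ ∫⁻ x, ∫⁻ y, G (x, y) :=
    lintegral_mono' Measure.restrict_le_self le_rfl
  -- Step 2: Tonelli and `∫⁻ ofReal = ofReal ∫` for the integrable non-negative `π² symG`
  have h3 : ∫⁻ x, ∫⁻ y, G (x, y) = ∫⁻ p, G p ∂(volume : Measure (EuclideanSpace ℝ (Fin 3) × EuclideanSpace ℝ (Fin 3))) := by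
    rw [Measure.volume_eq_prod, lintegral_prod _ (by rw [← Measure.volume_eq_prod]; exact hGm)]
  have hnn : 0 ≤ᵐ[volume] fun p : EuclideanSpace ℝ (Fin 3) × EuclideanSpace ℝ (Fin 3) => Real.pi ^ 2 * symG a f lamK p := by
    refine ae_of_all _ fun p => ?_
    unfold symG
    exact mul_nonneg (by positivity)
      (mul_nonneg (add_nonneg (hann _) (hann _)) (mul_nonneg (lamK_nonneg _) (sq_nonneg _)))
  have h4 : ∫⁻ p, G p ∂(volume : Measure (EuclideanSpace ℝ (Fin 3) × EuclideanSpace ℝ (Fin 3))) =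
      ENNReal.ofReal (∫ p, Real.pi ^ 2 * symG a f lamK p) := by
    rw [hG, ofReal_integral_eq_lintegral_ofReal (hint.const_mul _) hnn]
  have h5 : (∫ p, Real.pi ^ 2 * symG a f lamK p) = 4 * Real.pi ^ 2 * gagliardo a f := by
    rw [integral_const_mul, gagliardo_eq_integral_symG]; ring
  calc ∫⁻ x in S, ∫⁻ y, ‖f x - f y‖ₑ ^ (2 : ℝ) / ‖x - y‖ₑ ^ (4 : ℝ) ≤ ∫⁻ x in S, ∫⁻ y, G (x, y) := h1
    _ ≤ ∫⁻ x, ∫⁻ y, G (x, y) := h2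
    _ = ENNReal.ofReal (4 * Real.pi ^ 2 * gagliardo a f) := by rw [h3, h4, h5]

end Glue

/-! ### Door-class bookkeeping -/

section Class

variable {C D K : ℝ} {v : ℝ → EuclideanSpace ℝ (Fin 3) → EuclideanSpace ℝ (Fin 3)}

/-- `HasTypeIDecay D v` forces `0 ≤ D` (evaluate at any point of any slice). -/
theorem nonneg_of_hasTypeIDecay (hdecay : HasTypeIDecay D v) : 0 ≤ D := by
  have h := hdecay (-1) (by norm_num) 0
  have hpos : 0 < ‖(0 : EuclideanSpace ℝ (Fin 3))‖ + Real.sqrt (-(-1 : ℝ)) := by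
    rw [norm_zero, zero_add]; exact Real.sqrt_pos.2 (by norm_num)
  by_contra hD
  push Not at hD
  have : D / (‖(0 : EuclideanSpace ℝ (Fin 3))‖ + Real.sqrt (-(-1 : ℝ))) < 0 := div_neg_of_neg_of_pos hD hpos
  linarith [norm_nonneg (v (-1) 0)]

/-- **Scale-invariant decay of a slice**: `‖x‖ ‖v t x‖ ≤ D` for `t < 0` under `HasTypeIDecay D v`. -/
theorem norm_mul_norm_le_of_hasTypeIDecay (hdecay : HasTypeIDecay D v) {t : ℝ} (ht : t < 0)
    (x : EuclideanSpace ℝ (Fin 3)) : ‖x‖ * ‖v t x‖ ≤ D := by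
  have hD : 0 ≤ D := nonneg_of_hasTypeIDecay hdecay
  have hs : 0 < Real.sqrt (-t) := Real.sqrt_pos.2 (neg_pos.2 ht)
  have hb : 0 < ‖x‖ + Real.sqrt (-t) := by positivity
  have h := hdecay t ht x
  calc ‖x‖ * ‖v t x‖ ≤ ‖x‖ * (D / (‖x‖ + Real.sqrt (-t))) := mul_le_mul_of_nonneg_left h (norm_nonneg _)
    _ = D * (‖x‖ / (‖x‖ + Real.sqrt (-t))) := by ring
    _ ≤ D * 1 := by
        refine mul_le_mul_of_nonneg_left ((div_le_one hb).2 (by linarith)) hD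
    _ = D := mul_one D

/-- **The extended Gagliardo energy of a door-class slice over `B₂ × ℝ³` is bounded by `4π²` times its windowed
Gagliardo form with weight `bumpSq η 2`** (`= 1` on `B₂`); the class regularity of the slice makes the Gagliardo
integrand integrable. -/
theorem lintegral_ball_two_le_gagliardo_slice {η : EuclideanSpace ℝ (Fin 3) → ℝ} (hη : IsAdmissibleBump η)
    (hrate : HasTypeITimeDecay C v) (hder : HasTypeIDerivDecay K v)
    (hcont : ContinuousOn (Function.uncurry v) (Set.Iio (0 : ℝ) ×ˢ Set.univ))
    (hmild : ∀ s t : ℝ, s < t → t < 0 → ∀ x,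
      v t x = UnboundedOperators.heatExtension (v s) (t - s) x - oseenDuhamel 1 s v v t x)
    {t : ℝ} (ht : t < 0) :
    ∫⁻ x in ball (0 : EuclideanSpace ℝ (Fin 3)) 2, ∫⁻ y, ‖v t x - v t y‖ₑ ^ (2 : ℝ) / ‖x - y‖ₑ ^ (4 : ℝ) ≤
      ENNReal.ofReal (4 * Real.pi ^ 2 * gagliardo (bumpSq η 2) (v t)) := by
  obtain ⟨-, hfc, hf0, hf1, -⟩ := slice_regularity hrate hder hcont hmild ht
  have hac : Continuous (bumpSq η 2) := continuous_bumpSq hη 2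
  have hai : Integrable (bumpSq η 2) := hac.integrable_of_hasCompactSupport (hasCompactSupport_bumpSq hη two_pos)
  have hann : ∀ z, 0 ≤ bumpSq η 2 z := bumpSq_nonneg η 2
  have hint : Integrable (symG (bumpSq η 2) (v t) lamK) := integrable_symG_lamK hac hai hann hfc hf0 hf1
  refine setLIntegral_enorm_sq_div_le_gagliardo hann measurableSet_ball (fun x hx => ?_) hint
  rw [bumpSq_eq_one hη two_pos]
  have : ‖x‖ < 2 := by simpa [mem_ball, dist_zero_right] using hx
  exact this.le

/-- **Stub B5a in CLASS FORM, PROVED** (`stub_sobolevFatou` of nsreg-p1 `r19/Sketch20v5.lean` with the class's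
Oseen–Duhamel identity among the hypotheses — the form the residue composition consumes): a bound on the windowed
Gagliardo forms `gagliardo (bumpSq η R) (v t₀) ≤ c` uniform in `R > 0`, `t₀ < 0` for a door-class profile gives a
uniform `L³(B₁)` bound on the slices `v t`, `t ∈ (−1,0)` — by the localised fractional Gagliardo–Sobolev inequality
(Di Nezza–Palatucci–Valdinoci 2012 Thm 6.5 + Lemma 5.3, tree) at `R = 2` and the decay `‖x‖‖v t x‖ ≤ D`. -/
theorem sobolevFatou_of_class : ∀ (η : EuclideanSpace ℝ (Fin 3) → ℝ), IsAdmissibleBump η → ∀ (C D K : ℝ)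
    (v : ℝ → EuclideanSpace ℝ (Fin 3) → EuclideanSpace ℝ (Fin 3)),
    HasTypeITimeDecay C v → HasTypeIDecay D v → HasTypeIDerivDecay K v →
    ContinuousOn (Function.uncurry v) (Set.Iio (0 : ℝ) ×ˢ Set.univ) →
    (∀ s t : ℝ, s < t → t < 0 → ∀ x,
        v t x = UnboundedOperators.heatExtension (v s) (t - s) x - oseenDuhamel 1 s v v t x) →
    (∃ c : ℝ, ∀ R > (0 : ℝ), ∀ t₀ < (0 : ℝ), gagliardo (bumpSq η R) (v t₀) ≤ c) →
    ∃ M : NNReal, ∀ t ∈ Set.Ioo (-1 : ℝ) 0,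
      ∫⁻ x in Metric.ball (0 : EuclideanSpace ℝ (Fin 3)) 1, ‖v t x‖ₑ ^ (3 : ℕ) ≤ M := by
  intro η hη C D K v hrate hdecay hder hcont hmild hG
  obtain ⟨c, hc⟩ := hG
  obtain ⟨C₀, hC₀, hbd⟩ := exists_lintegral_ball_cube_le_rpow_of_decay_R3 (F := EuclideanSpace ℝ (Fin 3))
  -- the uniform majorant
  set Mₑ : ℝ≥0∞ := (C₀ * ENNReal.ofReal (4 * Real.pi ^ 2 * c) + C₀ * ENNReal.ofReal (D ^ 2)) ^ ((3 : ℝ) / 2)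
    with hMₑ
  have hMₑtop : Mₑ ≠ ⊤ := by
    refine ENNReal.rpow_ne_top_of_nonneg (by norm_num) ?_
    exact ENNReal.add_ne_top.2 ⟨ENNReal.mul_ne_top hC₀ ENNReal.ofReal_ne_top,
      ENNReal.mul_ne_top hC₀ ENNReal.ofReal_ne_top⟩
  refine ⟨Mₑ.toNNReal, fun t ht => ?_⟩
  rw [ENNReal.coe_toNNReal hMₑtop]
  have ht0 : t < 0 := ht.2
  obtain ⟨-, hfc, -, -, -⟩ := slice_regularity hrate hder hcont hmild ht0
  have hdec : ∀ x : EuclideanSpace ℝ (Fin 3), ‖x‖ * ‖v t x‖ ≤ D := norm_mul_norm_le_of_hasTypeIDecay hdecay ht0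
  have h1 := hbd D (v t) hfc.aestronglyMeasurable hdec
  have h2 : ∫⁻ x in ball (0 : EuclideanSpace ℝ (Fin 3)) 2, ∫⁻ y, ‖v t x - v t y‖ₑ ^ (2 : ℝ) / ‖x - y‖ₑ ^ (4 : ℝ) ≤
      ENNReal.ofReal (4 * Real.pi ^ 2 * c) :=
    (lintegral_ball_two_le_gagliardo_slice hη hrate hder hcont hmild ht0).trans
      (ENNReal.ofReal_le_ofReal (mul_le_mul_of_nonneg_left (hc 2 two_pos t ht0) (by positivity)))
  refine h1.trans ?_
  rw [hMₑ]
  gcongr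

end Class

end Summit.NavierStokesRegularity.NavierStokesRegularity.Theorems.ChiralWindowDoorSobolevFatou

end
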